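import Summits.Ventures.PercRepro.RankLevelSetLevelTwelveInfraGXT
import Summits.Ventures.PercRepro.RankLevelSetCoreElevenOfFormGXT

/-!
# PercRepro — THE `e`-FREE CORE AT LEVEL `12` FROM A NUMERIC FORM (THE GIANT-EXACT COUNT WITH LEMMA T5, THE CLOSED-FORM
MID WEIGHT) AND FROM THE LARGE-CORANK INEQUALITY (p2, gen 36; a feeder for S4 — the top of the `q = 12` window, from `2,768`)

* **`c025_core_twelve_of_form_gxt`** — the level-`12` instance of `c025_core_eleven_of_form_gxt`: the giant-exact count at `q = 12`
  with `f(12) ≤ 2559`, `f(11) ≤ 1279`, `ν_∩ ≤ 1268` (RankLevelSetLevelTwelveInfraGXT), Lemmas T / T4 / T5, `s_k ≤ C(d + k − 1, k)`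
  for `6 ≤ k ≤ 13`, the mid weight bounded by its closed form `σ̄` (`sigma_le_sigma_bar`), and the cell's form `(c₁, c₂)` as a
  HYPOTHESIS: `c₁·(C(n, 12) + σ̄·Π_E′ + 2^{min 2559 (12 + d)}) ≤ c₂·2^{d−12}·C(p + 12, 12)` and `c₁·G₁₂(d, n) ≤ (c₁ − c₂)·2^n`.
* **`c025_core_twelve_large_of_ineq_t`** — the core at level `12` from `2^{p+2559}·C(n, 12)/C(p+12, 12) + R₁₂(n) ≤ Σ_{12 ≤ k ≤ p−1} C(n, k)`.
Axioms: standard.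
-/

set_option exponentiation.threshold 8192

open scoped Matroid

namespace PercRepro
namespace ThmN
open Set
variable {α : Type}

set_option maxHeartbeats 6400000 in
/-- **The `e`-free core at level `12` from a numeric form ON THE GIANT-EXACT COUNT WITH LEMMA T5 AND THE CLOSED-FORM MID
WEIGHT**: the form `(c₁, c₂)` of the cell `(p, d)` is the `N`-side `c₁·(C(n, 12) + σ̄·Π_E′ + 2^{min 2559 (12+d)}) ≤
c₂·2^{d−12}·C(p+12, 12)` and the exact `Y`-tail, taken as a HYPOTHESIS; the partition count with the quartic multiplicity on the
non-giant sets (its mid weight `σ_m ≤ σ̄` by `sigma_le_sigma_bar`), the powerset of the giant flat, the nullity cap,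
`f(12) ≤ 2559`, `f(11) ≤ 1279`, Lemmas T and T4, and LEMMA T5 (`s₅ ≤ 7·d(d+1)(d+2)(d+3)/48`). -/
theorem c025_core_twelve_of_form_gxt (M : Matroid α) [M.Finite] (p d : ℕ) (hd13 : 13 ≤ d)
    (hR : M.eRank = (p : ℕ∞)) (hn : M.E.ncard = p + d)
    (hfree : ∀ e ∈ M.E, ∃ A ⊆ M.E \ {e}, e ∉ M.closure A ∧ e ∉ M.closure ((M.E \ {e}) \ A))
    (hform :
      ∃ c₁ c₂ : ℕ, 0 < c₂ ∧ c₂ < c₁ ∧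
    ((c₁ : ℕ) : ℚ) * ((((p + d).choose 12 : ℕ) : ℚ) + (∑ j ∈ Finset.range (min (d - 12) 60), ((Nat.choose (min 2546 (max ((d + min 1268 d) / 2 + 1) (min 1267 (d - 1) + 2) - 2)) j : ℕ) : ℚ) / (((j + 1) + 3 * (j + 1).choose 2 + 3 * (j + 1).choose 3 + 2 * (j + 1).choose 4 : ℕ) : ℚ) + (if 60 < d - 12 then (66 / 5 : ℚ) * 2 ^ (min 2546 (max ((d + min 1268 d) / 2 + 1) (min 1267 (d - 1) + 2) - 2) + 4) / ((((min 2546 (max ((d + min 1268 d) / 2 + 1) (min 1267 (d - 1) + 2) - 2)) + 1) * ((min 2546 (max ((d + min 1268 d) / 2 + 1) (min 1267 (d - 1) + 2) - 2)) + 2) * ((min 2546 (max ((d + min 1268 d) / 2 + 1) (min 1267 (d - 1) + 2) - 2)) + 3) * ((min 2546 (max ((d + min 1268 d) / 2 + 1) (min 1267 (d - 1) + 2) - 2)) + 4) : ℕ) : ℚ) else 0)) *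
      (((d * (d + 1) / 2 : ℕ) : ℚ) * ((p + d).choose 10 : ℚ) + ((d * (d + 1) * (d + 2) / 3 : ℕ) : ℚ) * ((p + d).choose 9 : ℚ) + ((7 * d * (d + 1) * (d + 2) * (d + 3) / 48 : ℕ) : ℚ) * ((p + d).choose 8 : ℚ) + (((d + 5).choose 6 : ℕ) : ℚ) * ((p + d).choose 7 : ℚ) + (((d + 6).choose 7 : ℕ) : ℚ) * ((p + d).choose 6 : ℚ) + (((d + 7).choose 8 : ℕ) : ℚ) * ((p + d).choose 5 : ℚ) + (((d + 8).choose 9 : ℕ) : ℚ) * ((p + d).choose 4 : ℚ) + (((d + 9).choose 10 : ℕ) : ℚ) * ((p + d).choose 3 : ℚ) + (((d + 10).choose 11 : ℕ) : ℚ) * ((p + d).choose 2 : ℚ) + (((d + 11).choose 12 : ℕ) : ℚ) * (p + d : ℚ) + (((d + 12).choose 13 : ℕ) : ℚ)) +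
      (2 : ℚ) ^ (min 2559 (12 + d))) ≤
      ((c₂ : ℕ) : ℚ) * 2 ^ (d - 12) * (((p + 12).choose 12 : ℕ) : ℚ) ∧
        c₁ * ((p + d).choose 12 * 2 ^ (min 2547 d) + (p + d).choose 11 * 2 ^ 1268 + (p + d).choose 10 * 2 ^ 629 + (p + d).choose 9 * 2 ^ 310 + (p + d).choose 8 * 2 ^ 151 + (p + d).choose 7 * 2 ^ 72 + (p + d).choose 6 * 2 ^ 33 + (p + d).choose 5 * 2 ^ 14 + (p + d).choose 4 * 2 ^ 6 + (p + d).choose 3 * 2 ^ 3 + (p + d).choose 2 * 2 + (p + d) + 1 + ∑ j ∈ Finset.range (d + 1), (p + d).choose j) ≤ (c₁ - c₂) * 2 ^ (p + d)) :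
    RLS M p 12 := by
  classical
  have hEcard : M.ground_finite.toFinset.card = p + d := by
    rw [← Set.ncard_eq_toFinset_card _ M.ground_finite]; exact hn
  have hL0 : ∀ e ∈ M.E, ¬ M.IsLoop e := not_isLoop_of_free M hfree
  have hs : ∀ e ∈ M.E, ∀ f ∈ M.E, e ≠ f → M.eRk {e, f} = 2 := by
    intro e he f hf hef
    have h2 : (2 : ℕ∞) ≤ M.eRk {e, f} :=
      two_le_eRk_of_two_le_ncard_of_free M hfree (pair_subset he hf) (by rw [ncard_pair hef])
    have h3 : M.eRk {e, f} ≤ 2 := by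
      have := M.eRk_le_encard {e, f}
      rwa [encard_pair hef] at this
    exact le_antisymm h3 h2
  have hcirc : ∀ C, M.IsCircuit C → 3 ≤ C.encard := three_le_encard_of_circuit M hL0 hs
  have hd : M.E.encard = M.eRank + d := by
    rw [hR, ← M.ground_finite.cast_ncard_eq, hn]
    push_cast
    ring
  have hcap : ∀ X ⊆ M.E, ∀ k : ℕ, M.eRk X ≤ k → X.ncard ≤ k + d := by
    intro X hX k hr
    have h1 := Matroid.encard_le_eRk_add_of_encard_eq hX hd
    have h2 : X.encard ≤ (k : ℕ∞) + d := h1.trans (by gcongr)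
    have hfin : X.Finite := M.ground_finite.subset hX
    rw [← hfin.cast_ncard_eq] at h2
    exact_mod_cast h2
  -- rank-`≤ 12` sets have `≤ min 2559 (12 + d)` points, rank-`≤ 11` sets `≤ min 1279 (11 + d)`
  have hflat : ∀ X ⊆ M.E, M.eRk X ≤ 12 → X.ncard ≤ min 2559 (12 + d) :=
    fun X hX hr => le_min (ncard_le_twenty_five_fifty_nine_of_eRk_le_twelve_of_free M hfree X hX hr) (hcap X hX 12 hr)
  have hflat' : ∀ X ⊆ M.E, M.eRk X ≤ ((12 - 1 : ℕ) : ℕ∞) → X.ncard ≤ min 1279 (11 + d) :=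
    fun X hX hr => le_min (ncard_le_twelve_seventy_nine_of_eRk_le_eleven_of_free M hfree X hX (by simpa using hr))
      (hcap X hX 11 (by simpa using hr))
  have hinter := hinter_twelve M hd hfree
  have hC1 : ∀ L ⊆ M.E, M.eRk L = 2 → L.ncard ≤ 3 :=
    fun L hL hr => ncard_le_three_of_eRk_two M hs hfree hL hr
  have hC1' : ∀ L ⊆ M.E, M.eRk L ≤ 2 → L.ncard ≤ 3 := by
    intro L hL' hr
    have := ncard_add_one_le_two_pow_of_eRk_le M hL0 hfree 2 L hL' hr
    omega
  have hC2 : ∀ P ⊆ M.E, M.eRk P ≤ 3 → P.ncard ≤ 6 :=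
    fun P hP hr => ncard_le_six_of_eRk_le_three_of_free M hfree hP hr
  have hs3 : {C | M.IsCircuit C ∧ C.ncard = 3}.ncard ≤ d * (d + 1) / 2 := by
    have hT : 2 * {C | M.IsCircuit C ∧ C.ncard = 3}.ncard ≤ d * (d + 1) := S1.two_mul_ncard_triangles_le M hC1 hd
    omega
  have hs4 : {C | M.IsCircuit C ∧ C.ncard = 4}.ncard ≤ d * (d + 1) * (d + 2) / 3 := by
    have hT4 : 3 * {C : Set α | M.IsCircuit C ∧ C.ncard = 4}.ncard ≤ d * (d + 1) * (d + 2) :=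
      S1.three_mul_ncard_four_circuits_le M hC1' hC2 hd
    omega
  have hs5 : {C | M.IsCircuit C ∧ C.ncard = 5}.ncard ≤ 7 * d * (d + 1) * (d + 2) * (d + 3) / 48 := by
    have h := S1.fortyEight_mul_ncard_five_circuits_le M 7
      (fun X hX hr => by simpa using ncard_le_ten_of_eRk_le_four_of_free M hfree hX hr) hd
    rw [Nat.le_div_iff_mul_le (by norm_num)]
    linarith [h]
  have hs6 : {C | M.IsCircuit C ∧ C.ncard = 6}.ncard ≤ (d + 5).choose 6 :=
    Matroid.ncard_circuits_le_choose_of_encard M hd 5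
  have hs7 : {C | M.IsCircuit C ∧ C.ncard = 7}.ncard ≤ (d + 6).choose 7 :=
    Matroid.ncard_circuits_le_choose_of_encard M hd 6
  have hs8 : {C | M.IsCircuit C ∧ C.ncard = 8}.ncard ≤ (d + 7).choose 8 :=
    Matroid.ncard_circuits_le_choose_of_encard M hd 7
  have hs9 : {C | M.IsCircuit C ∧ C.ncard = 9}.ncard ≤ (d + 8).choose 9 :=
    Matroid.ncard_circuits_le_choose_of_encard M hd 8
  have hs10 : {C | M.IsCircuit C ∧ C.ncard = 10}.ncard ≤ (d + 9).choose 10 :=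
    Matroid.ncard_circuits_le_choose_of_encard M hd 9
  have hs11 : {C | M.IsCircuit C ∧ C.ncard = 11}.ncard ≤ (d + 10).choose 11 :=
    Matroid.ncard_circuits_le_choose_of_encard M hd 10
  have hs12 : {C | M.IsCircuit C ∧ C.ncard = 12}.ncard ≤ (d + 11).choose 12 :=
    Matroid.ncard_circuits_le_choose_of_encard M hd 11
  have hs13 : {C | M.IsCircuit C ∧ C.ncard = 13}.ncard ≤ (d + 12).choose 13 :=
    Matroid.ncard_circuits_le_choose_of_encard M hd 12
  -- (U): the partition count with the three-multiplicity, in `ℚ`, then the circuit bounds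
  have hU0 := S2.ncard_eRk_eq_ncard_le_le_giant_exact M 12 (min 2559 (12 + d)) (min 1279 (11 + d))
    (max ((d + min 1268 d) / 2 + 1) (min 1267 (d - 1) + 2)) (min 1268 d)
    (by norm_num) hcirc hC1 hC2 hflat hflat' hinter hd (by omega) (by omega)
  have hU1 := Matroid.topCount_le_ncard_compl (M := M) hR hd 12
  have hm1 : min (min 2559 (12 + d) - (12 + 1)) (max ((d + min 1268 d) / 2 + 1) (min 1267 (d - 1) + 2) - 2) =
      min 2546 (max ((d + min 1268 d) / 2 + 1) (min 1267 (d - 1) + 2) - 2) := by omega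
  have hm3 : min (min 2559 (12 + d)) (12 + d) = min 2559 (12 + d) := by omega
  rw [hn, sum_Icc_three_thirteen_q, hm1, hm3, show d - (12 + 1) + 1 = d - 12 by omega] at hU0
  simp only [show (12 : ℕ) + 1 = 13 from rfl, show (13 : ℕ) - 3 = 10 from rfl, show (13 : ℕ) - 4 = 9 from rfl,
    show (13 : ℕ) - 5 = 8 from rfl, show (13 : ℕ) - 6 = 7 from rfl, show (13 : ℕ) - 7 = 6 from rfl,
    show (13 : ℕ) - 8 = 5 from rfl, show (13 : ℕ) - 9 = 4 from rfl, show (13 : ℕ) - 10 = 3 from rfl,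
    show (13 : ℕ) - 11 = 2 from rfl, show (13 : ℕ) - 12 = 1 from rfl, show (13 : ℕ) - 13 = 0 from rfl, Nat.choose_one_right, Nat.choose_zero_right] at hU0
  have hUq : (Matroid.topCount M p 12 : ℚ) ≤ ((p + d).choose 12 : ℚ) +
      (∑ j ∈ Finset.range (min (d - 12) 60), ((Nat.choose (min 2546 (max ((d + min 1268 d) / 2 + 1) (min 1267 (d - 1) + 2) - 2)) j : ℕ) : ℚ) / (((j + 1) + 3 * (j + 1).choose 2 + 3 * (j + 1).choose 3 + 2 * (j + 1).choose 4 : ℕ) : ℚ) + (if 60 < d - 12 then (66 / 5 : ℚ) * 2 ^ (min 2546 (max ((d + min 1268 d) / 2 + 1) (min 1267 (d - 1) + 2) - 2) + 4) / ((((min 2546 (max ((d + min 1268 d) / 2 + 1) (min 1267 (d - 1) + 2) - 2)) + 1) * ((min 2546 (max ((d + min 1268 d) / 2 + 1) (min 1267 (d - 1) + 2) - 2)) + 2) * ((min 2546 (max ((d + min 1268 d) / 2 + 1) (min 1267 (d - 1) + 2) - 2)) + 3) * ((min 2546 (max ((d + min 1268 d) / 2 + 1) (min 1267 (d - 1) +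 2) - 2)) + 4) : ℕ) : ℚ) else 0)) *
        (((d * (d + 1) / 2 : ℕ) : ℚ) * ((p + d).choose 10 : ℚ) + ((d * (d + 1) * (d + 2) / 3 : ℕ) : ℚ) * ((p + d).choose 9 : ℚ) + ((7 * d * (d + 1) * (d + 2) * (d + 3) / 48 : ℕ) : ℚ) * ((p + d).choose 8 : ℚ) + (((d + 5).choose 6 : ℕ) : ℚ) * ((p + d).choose 7 : ℚ) + (((d + 6).choose 7 : ℕ) : ℚ) * ((p + d).choose 6 : ℚ) + (((d + 7).choose 8 : ℕ) : ℚ) * ((p + d).choose 5 : ℚ) + (((d + 8).choose 9 : ℕ) : ℚ) * ((p + d).choose 4 : ℚ) + (((d + 9).choose 10 : ℕ) : ℚ) * ((p + d).choose 3 : ℚ) + (((d + 10).choose 11 : ℕ) : ℚ) * ((p + d).choose 2 : ℚ) + (((d + 11).choose 12 : ℕ) : ℚ) * (p + d : ℚ) + (((d + 12).choose 13 : ℕ) : ℚ)) +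
      (2 : ℚ) ^ (min 2559 (12 + d)) := by
    have hU1q : (Matroid.topCount M p 12 : ℚ) ≤
        ({B : Set α | B ⊆ M.E ∧ M.eRk B = 12 ∧ B.ncard ≤ d}.ncard : ℚ) := by exact_mod_cast hU1
    have hsm : {C | M.IsCircuit C ∧ C.ncard = 3}.ncard * (p + d).choose 10 +
        {C | M.IsCircuit C ∧ C.ncard = 4}.ncard * (p + d).choose 9 +
        {C | M.IsCircuit C ∧ C.ncard = 5}.ncard * (p + d).choose 8 +
        {C | M.IsCircuit C ∧ C.ncard = 6}.ncard * (p + d).choose 7 +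
        {C | M.IsCircuit C ∧ C.ncard = 7}.ncard * (p + d).choose 6 +
        {C | M.IsCircuit C ∧ C.ncard = 8}.ncard * (p + d).choose 5 +
        {C | M.IsCircuit C ∧ C.ncard = 9}.ncard * (p + d).choose 4 +
        {C | M.IsCircuit C ∧ C.ncard = 10}.ncard * (p + d).choose 3 +
        {C | M.IsCircuit C ∧ C.ncard = 11}.ncard * (p + d).choose 2 +
        {C | M.IsCircuit C ∧ C.ncard = 12}.ncard * (p + d) +
        {C | M.IsCircuit C ∧ C.ncard = 13}.ncard * 1 ≤
        d * (d + 1) / 2 * (p + d).choose 10 +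
          d * (d + 1) * (d + 2) / 3 * (p + d).choose 9 +
          7 * d * (d + 1) * (d + 2) * (d + 3) / 48 * (p + d).choose 8 +
          (d + 5).choose 6 * (p + d).choose 7 +
          (d + 6).choose 7 * (p + d).choose 6 +
          (d + 7).choose 8 * (p + d).choose 5 +
          (d + 8).choose 9 * (p + d).choose 4 +
          (d + 9).choose 10 * (p + d).choose 3 +
          (d + 10).choose 11 * (p + d).choose 2 +
          (d + 11).choose 12 * (p + d) +
          (d + 12).choose 13 := by
      have := hs13
      gcongr
      omega
    have hsmq : (({C | M.IsCircuit C ∧ C.ncard = 3}.ncard : ℚ) * ((p + d).choose 10 : ℚ) +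
        ({C | M.IsCircuit C ∧ C.ncard = 4}.ncard : ℚ) * ((p + d).choose 9 : ℚ) +
        ({C | M.IsCircuit C ∧ C.ncard = 5}.ncard : ℚ) * ((p + d).choose 8 : ℚ) +
        ({C | M.IsCircuit C ∧ C.ncard = 6}.ncard : ℚ) * ((p + d).choose 7 : ℚ) +
        ({C | M.IsCircuit C ∧ C.ncard = 7}.ncard : ℚ) * ((p + d).choose 6 : ℚ) +
        ({C | M.IsCircuit C ∧ C.ncard = 8}.ncard : ℚ) * ((p + d).choose 5 : ℚ) +
        ({C | M.IsCircuit C ∧ C.ncard = 9}.ncard : ℚ) * ((p + d).choose 4 : ℚ) +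
        ({C | M.IsCircuit C ∧ C.ncard = 10}.ncard : ℚ) * ((p + d).choose 3 : ℚ) +
        ({C | M.IsCircuit C ∧ C.ncard = 11}.ncard : ℚ) * ((p + d).choose 2 : ℚ) +
        ({C | M.IsCircuit C ∧ C.ncard = 12}.ncard : ℚ) * ((p + d : ℕ) : ℚ) +
        ({C | M.IsCircuit C ∧ C.ncard = 13}.ncard : ℚ) * ((1 : ℕ) : ℚ)) ≤
        ((d * (d + 1) / 2 * (p + d).choose 10 +
          d * (d + 1) * (d + 2) / 3 * (p + d).choose 9 +
          7 * d * (d + 1) * (d + 2) * (d + 3) / 48 * (p + d).choose 8 +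
          (d + 5).choose 6 * (p + d).choose 7 +
          (d + 6).choose 7 * (p + d).choose 6 +
          (d + 7).choose 8 * (p + d).choose 5 +
          (d + 8).choose 9 * (p + d).choose 4 +
          (d + 9).choose 10 * (p + d).choose 3 +
          (d + 10).choose 11 * (p + d).choose 2 +
          (d + 11).choose 12 * (p + d) +
          (d + 12).choose 13 : ℕ) : ℚ) := by
      exact_mod_cast hsm
    have hσm0 : (0 : ℚ) ≤ ∑ j ∈ Finset.range (d - 12), ((Nat.choose (min 2546 (max ((d + min 1268 d) / 2 + 1) (min 1267 (d - 1) + 2) - 2)) j : ℕ) : ℚ) / (((j + 1) + 3 * (j + 1).choose 2 + 3 * (j + 1).choose 3 + 2 * (j + 1).choose 4 : ℕ) : ℚ) :=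
      Finset.sum_nonneg (fun j _ => by positivity)
    have hσbar : ∑ j ∈ Finset.range (d - 12), ((Nat.choose (min 2546 (max ((d + min 1268 d) / 2 + 1) (min 1267 (d - 1) + 2) - 2)) j : ℕ) : ℚ) / (((j + 1) + 3 * (j + 1).choose 2 + 3 * (j + 1).choose 3 + 2 * (j + 1).choose 4 : ℕ) : ℚ) ≤ (∑ j ∈ Finset.range (min (d - 12) 60), ((Nat.choose (min 2546 (max ((d + min 1268 d) / 2 + 1) (min 1267 (d - 1) + 2) - 2)) j : ℕ) : ℚ) / (((j + 1) + 3 * (j + 1).choose 2 + 3 * (j + 1).choose 3 + 2 * (j + 1).choose 4 : ℕ) : ℚ) + (if 60 < d - 12 then (66 / 5 : ℚ) * 2 ^ (min 2546 (max ((d + min 1268 d) / 2 + 1) (min 1267 (d - 1) + 2) - 2) + 4) / ((((min 2546 (max ((d + min 1268 d) / 2 + 1) (min 1267 (d - 1) + 2) - 2)) + 1) * ((min 2546 (max ((d + min 1268 d) / 2 + 1) (min 1267 (d - 1) + 2) - 2)) + 2) * ((min 2546 (max ((d + min 1268 d) / 2 + 1) (min 1267 (d - 1) + 2) - 2)) +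 3) * ((min 2546 (max ((d + min 1268 d) / 2 + 1) (min 1267 (d - 1) + 2) - 2)) + 4) : ℕ) : ℚ) else 0)) := sigma_le_sigma_bar _ _
    have hPi0 : (0 : ℚ) ≤ ((d * (d + 1) / 2 * (p + d).choose 10 +
          d * (d + 1) * (d + 2) / 3 * (p + d).choose 9 +
          7 * d * (d + 1) * (d + 2) * (d + 3) / 48 * (p + d).choose 8 +
          (d + 5).choose 6 * (p + d).choose 7 +
          (d + 6).choose 7 * (p + d).choose 6 +
          (d + 7).choose 8 * (p + d).choose 5 +
          (d + 8).choose 9 * (p + d).choose 4 +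
          (d + 9).choose 10 * (p + d).choose 3 +
          (d + 10).choose 11 * (p + d).choose 2 +
          (d + 11).choose 12 * (p + d) +
          (d + 12).choose 13 : ℕ) : ℚ) := Nat.cast_nonneg _
    refine hU1q.trans (hU0.trans ?_)
    have e1 := mul_le_mul_of_nonneg_left hsmq hσm0
    have e2 := mul_le_mul_of_nonneg_right hσbar hPi0
    push_cast at e1 e2 ⊢
    linarith
  -- (Y): the rank-`≤ 11` sets through their closures; the spanning sets by the `5/2` tail
  have hY := Matroid.two_pow_le_midCount_add (M := M) p 12 hR
  have hsum12 := S2.ncard_eRk_le_le_sum M 12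
  simp only [Finset.sum_range_succ, Finset.sum_range_zero, zero_add] at hsum12
  have hB := Matroid.ncard_spanning_le (M := M) hd
  rw [hEcard] at hY hB
  obtain ⟨c₁, c₂, hc₂, hc₁₂, hpolyq, hT⟩ := hform
  have hAB : c₁ * ({X : Set α | X ⊆ M.E ∧ M.eRk X ≤ 12}.ncard +
      {X : Set α | X ⊆ M.E ∧ M.eRk X = M.eRank}.ncard) ≤ (c₁ - c₂) * 2 ^ (p + d) := by
    have h12 : {X : Set α | X ⊆ M.E ∧ M.eRk X = (12 : ℕ)}.ncard ≤ M.E.ncard.choose 12 * 2 ^ (min 2547 d) := by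
      have := S2.ncard_eRk_eq_le_choose_mul_two_pow M 12 (min 2559 (12 + d))
        (fun X hX hr => hflat X hX (by exact_mod_cast hr))
      rwa [show min 2559 (12 + d) - 12 = min 2547 d by omega] at this
    have h11 : {X : Set α | X ⊆ M.E ∧ M.eRk X = (11 : ℕ)}.ncard ≤ M.E.ncard.choose 11 * 2 ^ (1279 - 11) :=
      S2.ncard_eRk_eq_le_choose_mul_two_pow M 11 1279
        (fun X hX hr => ncard_le_twelve_seventy_nine_of_eRk_le_eleven_of_free M hfree X hX (by exact_mod_cast hr))
    have h10 : {X : Set α | X ⊆ M.E ∧ M.eRk X = (10 : ℕ)}.ncard ≤ M.E.ncard.choose 10 * 2 ^ (639 - 10) :=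
      S2.ncard_eRk_eq_le_choose_mul_two_pow M 10 639
        (fun X hX hr => ncard_le_six_thirty_nine_of_eRk_le_ten_of_free M hfree X hX (by exact_mod_cast hr))
    have h9 : {X : Set α | X ⊆ M.E ∧ M.eRk X = (9 : ℕ)}.ncard ≤ M.E.ncard.choose 9 * 2 ^ (319 - 9) :=
      S2.ncard_eRk_eq_le_choose_mul_two_pow M 9 319
        (fun X hX hr => ncard_le_three_nineteen_of_eRk_le_nine_of_free M hfree X hX (by exact_mod_cast hr))
    have h8 : {X : Set α | X ⊆ M.E ∧ M.eRk X = (8 : ℕ)}.ncard ≤ M.E.ncard.choose 8 * 2 ^ (159 - 8) :=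
      S2.ncard_eRk_eq_le_choose_mul_two_pow M 8 159
        (fun X hX hr => ncard_le_one_fifty_nine_of_eRk_le_eight_of_free M hfree X hX (by exact_mod_cast hr))
    have h7 : {X : Set α | X ⊆ M.E ∧ M.eRk X = (7 : ℕ)}.ncard ≤ M.E.ncard.choose 7 * 2 ^ (79 - 7) :=
      S2.ncard_eRk_eq_le_choose_mul_two_pow M 7 79
        (fun X hX hr => ncard_le_seventynine_of_eRk_le_seven_of_free M hfree X hX (by exact_mod_cast hr))
    have h6 : {X : Set α | X ⊆ M.E ∧ M.eRk X = (6 : ℕ)}.ncard ≤ M.E.ncard.choose 6 * 2 ^ (39 - 6) :=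
      S2.ncard_eRk_eq_le_choose_mul_two_pow M 6 39
        (fun X hX hr => ncard_le_thirtynine_of_eRk_le_six_of_free M hfree hX (by exact_mod_cast hr))
    have h5 : {X : Set α | X ⊆ M.E ∧ M.eRk X = (5 : ℕ)}.ncard ≤ M.E.ncard.choose 5 * 2 ^ (19 - 5) :=
      S2.ncard_eRk_eq_le_choose_mul_two_pow M 5 19
        (fun X hX hr => ncard_le_nineteen_of_eRk_le_five_of_free M hfree hX (by exact_mod_cast hr))
    have h4 : {X : Set α | X ⊆ M.E ∧ M.eRk X = (4 : ℕ)}.ncard ≤ M.E.ncard.choose 4 * 2 ^ (10 - 4) :=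
      S2.ncard_eRk_eq_le_choose_mul_two_pow M 4 10
        (fun X hX hr => ncard_le_ten_of_eRk_le_four_of_free M hfree hX (by exact_mod_cast hr))
    have h3 : {X : Set α | X ⊆ M.E ∧ M.eRk X = (3 : ℕ)}.ncard ≤ M.E.ncard.choose 3 * 2 ^ (6 - 3) :=
      S2.ncard_eRk_eq_le_choose_mul_two_pow M 3 6
        (fun X hX hr => ncard_le_six_of_eRk_le_three_of_free M hfree hX (by exact_mod_cast hr))
    have h2 : {X : Set α | X ⊆ M.E ∧ M.eRk X = (2 : ℕ)}.ncard ≤ M.E.ncard.choose 2 * 2 ^ (3 - 2) :=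
      S2.ncard_eRk_eq_le_choose_mul_two_pow M 2 3
        (fun X hX hr => by have := ncard_add_one_le_two_pow_of_eRk_le M hL0 hfree 2 X hX hr; omega)
    have h1 : {X : Set α | X ⊆ M.E ∧ M.eRk X = (1 : ℕ)}.ncard ≤ M.E.ncard.choose 1 * 2 ^ (1 - 1) :=
      S2.ncard_eRk_eq_le_choose_mul_two_pow M 1 1
        (fun X hX hr => by have := ncard_add_one_le_two_pow_of_eRk_le M hL0 hfree 1 X hX hr; omega)
    have h0 : {X : Set α | X ⊆ M.E ∧ M.eRk X = (0 : ℕ)}.ncard ≤ M.E.ncard.choose 0 * 2 ^ (0 - 0) :=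
      S2.ncard_eRk_eq_le_choose_mul_two_pow M 0 0
        (fun X hX hr => by have := ncard_add_one_le_two_pow_of_eRk_le M hL0 hfree 0 X hX hr; omega)
    simp only [Nat.choose_one_right, Nat.choose_zero_right, Nat.sub_self, pow_zero, mul_one] at h1 h0
    rw [hn] at h12 h11 h10 h9 h8 h7 h6 h5 h4 h3 h2 h1
    push_cast at hsum12 h12 h11 h10 h9 h8 h7 h6 h5 h4 h3 h2 h1 h0
    have hA : {X : Set α | X ⊆ M.E ∧ M.eRk X ≤ 12}.ncard ≤
        (p + d).choose 12 * 2 ^ (min 2547 d) + (p + d).choose 11 * 2 ^ 1268 + (p + d).choose 10 * 2 ^ 629 + (p + d).choose 9 * 2 ^ 310 + (p + d).choose 8 * 2 ^ 151 + (p + d).choose 7 * 2 ^ 72 +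
          (p + d).choose 6 * 2 ^ 33 + (p + d).choose 5 * 2 ^ 14 + (p + d).choose 4 * 2 ^ 6 + (p + d).choose 3 * 2 ^ 3 +
          (p + d).choose 2 * 2 + (p + d) + 1 := by
      omega
    have hG : {X : Set α | X ⊆ M.E ∧ M.eRk X ≤ 12}.ncard + {X : Set α | X ⊆ M.E ∧ M.eRk X = M.eRank}.ncard ≤
        (p + d).choose 12 * 2 ^ (min 2547 d) + (p + d).choose 11 * 2 ^ 1268 + (p + d).choose 10 * 2 ^ 629 + (p + d).choose 9 * 2 ^ 310 + (p + d).choose 8 * 2 ^ 151 + (p + d).choose 7 * 2 ^ 72 +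
          (p + d).choose 6 * 2 ^ 33 + (p + d).choose 5 * 2 ^ 14 + (p + d).choose 4 * 2 ^ 6 + (p + d).choose 3 * 2 ^ 3 +
          (p + d).choose 2 * 2 + (p + d) + 1 + ∑ j ∈ Finset.range (d + 1), (p + d).choose j := by
      omega
    exact le_trans (Nat.mul_le_mul_left _ hG) hT
  have hΦ := phiK_le_two_pow_div p 12
  rw [Nat.choose_symm_add] at hΦ
  rw [add_assoc] at hpolyq hUq
  rw [RLS_iff]
  have hYq : (2 : ℚ) ^ (p + d) ≤ (Matroid.midCount M p 12 : ℚ) +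
      ({X : Set α | X ⊆ M.E ∧ M.eRk X ≤ 12}.ncard : ℚ) +
      ({X : Set α | X ⊆ M.E ∧ M.eRk X = M.eRank}.ncard : ℚ) := by exact_mod_cast hY
  have hABq : (c₁ : ℚ) * (({X : Set α | X ⊆ M.E ∧ M.eRk X ≤ 12}.ncard : ℚ) +
      ({X : Set α | X ⊆ M.E ∧ M.eRk X = M.eRank}.ncard : ℚ)) ≤
      ((c₁ - c₂ : ℕ) : ℚ) * 2 ^ (p + d) := by exact_mod_cast hAB
  have hU0' : (0 : ℚ) ≤ (Matroid.topCount M p 12 : ℚ) := Nat.cast_nonneg _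
  have hd12 : 12 ≤ d := by omega
  exact level_arith_form (p := p) (d := d) (n := p + d) (q := 12) rfl hd12 hc₂ hc₁₂ hΦ hU0' hUq hYq hABq hpolyq

set_option maxHeartbeats 1600000 in
/-- **The `e`-free core at level `12` from the large-corank inequality** (the level-`12` instance of
`c025_core_eleven_large_of_ineq_t`): `Φ·#U ≤ #Y` — `#U ≤ C(n, 12)·2^2547` (the flat bound `2559`),
`#Y ≥ Σ_{12 ≤ k ≤ p−1} C(n, k) − #{r ≤ 12}`, `#{r ≤ 12} ≤ R₁₂(n)`, `Φ ≤ 2^{p+12}/C(p+12, 12)`. -/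
theorem c025_core_twelve_large_of_ineq_t (M : Matroid α) [M.Finite] (p : ℕ) (hR : M.eRank = (p : ℕ∞))
    (hineq : (2 : ℚ) ^ (p + 2559) * (M.E.ncard.choose 12 : ℚ) / ((p + 12).choose 12 : ℚ) +
      ((M.E.ncard.choose 12 * 2 ^ 2547 + M.E.ncard.choose 11 * 2 ^ 1268 + M.E.ncard.choose 10 * 2 ^ 629 + M.E.ncard.choose 9 * 2 ^ 310 + M.E.ncard.choose 8 * 2 ^ 151 + M.E.ncard.choose 7 * 2 ^ 72 + M.E.ncard.choose 6 * 2 ^ 33 +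
        M.E.ncard.choose 5 * 2 ^ 14 + M.E.ncard.choose 4 * 2 ^ 6 + M.E.ncard.choose 3 * 2 ^ 3 + M.E.ncard.choose 2 * 2 + M.E.ncard + 1 : ℕ) : ℚ) ≤
      ((∑ k ∈ Finset.Ico 12 p, M.E.ncard.choose k : ℕ) : ℚ))
    (hfree : ∀ e ∈ M.E, ∃ A ⊆ M.E \ {e}, e ∉ M.closure A ∧ e ∉ M.closure ((M.E \ {e}) \ A)) :
    RLS M p 12 := by
  classical
  set n := M.E.ncard with hn_def
  set d := n - p with hd_def
  have hnd : n = p + d := by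
    have := M.eRank_le_encard_ground
    rw [hR, ← M.ground_finite.cast_ncard_eq] at this
    have hpn : p ≤ n := by exact_mod_cast this
    omega
  have hEcard : M.ground_finite.toFinset.card = n := by
    rw [hn_def, Set.ncard_eq_toFinset_card _ M.ground_finite]
  have hencard : M.E.encard = M.eRank + d := by
    rw [hR, ← M.ground_finite.cast_ncard_eq, ← hn_def, hnd]
    push_cast
    ring
  have hL0 : ∀ e ∈ M.E, ¬ M.IsLoop e := not_isLoop_of_free M hfree
  -- (U): the rank-`12` sets through the flat bound `2559`
  have hflat : ∀ X ⊆ M.E, M.eRk X ≤ 12 → X.ncard ≤ 2559 :=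
    fun X hX hr => ncard_le_twenty_five_fifty_nine_of_eRk_le_twelve_of_free M hfree X hX hr
  have hU : Matroid.topCount M p 12 ≤ n.choose 12 * 2 ^ 2547 := by
    calc Matroid.topCount M p 12 ≤ Matroid.levelCount M 12 := Matroid.topCount_le_levelCount_bot p 12
      _ = {X : Set α | X ⊆ M.E ∧ M.eRk X = (12 : ℕ)}.ncard := rfl
      _ ≤ n.choose 12 * 2 ^ (2559 - 12) := by
          rw [← hEcard]; exact ncard_eRk_eq_le_choose_mul_of_bound M 12 2559 hflat
  -- (A): the rank-`≤ 12` sets through the flat bounds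
  have hsum12 := S2.ncard_eRk_le_le_sum M 12
  simp only [Finset.sum_range_succ, Finset.sum_range_zero, zero_add] at hsum12
  have h12 : {X : Set α | X ⊆ M.E ∧ M.eRk X = (12 : ℕ)}.ncard ≤ M.E.ncard.choose 12 * 2 ^ (2559 - 12) :=
    S2.ncard_eRk_eq_le_choose_mul_two_pow M 12 2559 (fun X hX hr => hflat X hX (by exact_mod_cast hr))
  have h11 : {X : Set α | X ⊆ M.E ∧ M.eRk X = (11 : ℕ)}.ncard ≤ M.E.ncard.choose 11 * 2 ^ (1279 - 11) :=
    S2.ncard_eRk_eq_le_choose_mul_two_pow M 11 1279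
      (fun X hX hr => ncard_le_twelve_seventy_nine_of_eRk_le_eleven_of_free M hfree X hX (by exact_mod_cast hr))
  have h10 : {X : Set α | X ⊆ M.E ∧ M.eRk X = (10 : ℕ)}.ncard ≤ M.E.ncard.choose 10 * 2 ^ (639 - 10) :=
    S2.ncard_eRk_eq_le_choose_mul_two_pow M 10 639
      (fun X hX hr => ncard_le_six_thirty_nine_of_eRk_le_ten_of_free M hfree X hX (by exact_mod_cast hr))
  have h9 : {X : Set α | X ⊆ M.E ∧ M.eRk X = (9 : ℕ)}.ncard ≤ M.E.ncard.choose 9 * 2 ^ (319 - 9) :=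
    S2.ncard_eRk_eq_le_choose_mul_two_pow M 9 319
      (fun X hX hr => ncard_le_three_nineteen_of_eRk_le_nine_of_free M hfree X hX (by exact_mod_cast hr))
  have h8 : {X : Set α | X ⊆ M.E ∧ M.eRk X = (8 : ℕ)}.ncard ≤ M.E.ncard.choose 8 * 2 ^ (159 - 8) :=
    S2.ncard_eRk_eq_le_choose_mul_two_pow M 8 159
      (fun X hX hr => ncard_le_one_fifty_nine_of_eRk_le_eight_of_free M hfree X hX (by exact_mod_cast hr))
  have h7 : {X : Set α | X ⊆ M.E ∧ M.eRk X = (7 : ℕ)}.ncard ≤ M.E.ncard.choose 7 * 2 ^ (79 - 7) :=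
    S2.ncard_eRk_eq_le_choose_mul_two_pow M 7 79
      (fun X hX hr => ncard_le_seventynine_of_eRk_le_seven_of_free M hfree X hX (by exact_mod_cast hr))
  have h6 : {X : Set α | X ⊆ M.E ∧ M.eRk X = (6 : ℕ)}.ncard ≤ M.E.ncard.choose 6 * 2 ^ (39 - 6) :=
    S2.ncard_eRk_eq_le_choose_mul_two_pow M 6 39
      (fun X hX hr => ncard_le_thirtynine_of_eRk_le_six_of_free M hfree hX (by exact_mod_cast hr))
  have h5 : {X : Set α | X ⊆ M.E ∧ M.eRk X = (5 : ℕ)}.ncard ≤ M.E.ncard.choose 5 * 2 ^ (19 - 5) :=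
    S2.ncard_eRk_eq_le_choose_mul_two_pow M 5 19
      (fun X hX hr => ncard_le_nineteen_of_eRk_le_five_of_free M hfree hX (by exact_mod_cast hr))
  have h4 : {X : Set α | X ⊆ M.E ∧ M.eRk X = (4 : ℕ)}.ncard ≤ M.E.ncard.choose 4 * 2 ^ (10 - 4) :=
    S2.ncard_eRk_eq_le_choose_mul_two_pow M 4 10
      (fun X hX hr => ncard_le_ten_of_eRk_le_four_of_free M hfree hX (by exact_mod_cast hr))
  have h3 : {X : Set α | X ⊆ M.E ∧ M.eRk X = (3 : ℕ)}.ncard ≤ M.E.ncard.choose 3 * 2 ^ (6 - 3) :=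
    S2.ncard_eRk_eq_le_choose_mul_two_pow M 3 6
      (fun X hX hr => ncard_le_six_of_eRk_le_three_of_free M hfree hX (by exact_mod_cast hr))
  have h2 : {X : Set α | X ⊆ M.E ∧ M.eRk X = (2 : ℕ)}.ncard ≤ M.E.ncard.choose 2 * 2 ^ (3 - 2) :=
    S2.ncard_eRk_eq_le_choose_mul_two_pow M 2 3
      (fun X hX hr => by have := ncard_add_one_le_two_pow_of_eRk_le M hL0 hfree 2 X hX hr; omega)
  have h1 : {X : Set α | X ⊆ M.E ∧ M.eRk X = (1 : ℕ)}.ncard ≤ M.E.ncard.choose 1 * 2 ^ (1 - 1) :=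
    S2.ncard_eRk_eq_le_choose_mul_two_pow M 1 1
      (fun X hX hr => by have := ncard_add_one_le_two_pow_of_eRk_le M hL0 hfree 1 X hX hr; omega)
  have h0 : {X : Set α | X ⊆ M.E ∧ M.eRk X = (0 : ℕ)}.ncard ≤ M.E.ncard.choose 0 * 2 ^ (0 - 0) :=
    S2.ncard_eRk_eq_le_choose_mul_two_pow M 0 0
      (fun X hX hr => by have := ncard_add_one_le_two_pow_of_eRk_le M hL0 hfree 0 X hX hr; omega)
  simp only [Nat.choose_one_right, Nat.choose_zero_right, Nat.sub_self, pow_zero, mul_one] at h1 h0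
  rw [← hn_def] at h12 h11 h10 h9 h8 h7 h6 h5 h4 h3 h2 h1
  push_cast at hsum12 h12 h11 h10 h9 h8 h7 h6 h5 h4 h3 h2 h1 h0
  have hA : {X : Set α | X ⊆ M.E ∧ M.eRk X ≤ 12}.ncard ≤
      n.choose 12 * 2 ^ 2547 + n.choose 11 * 2 ^ 1268 + n.choose 10 * 2 ^ 629 + n.choose 9 * 2 ^ 310 + n.choose 8 * 2 ^ 151 + n.choose 7 * 2 ^ 72 + n.choose 6 * 2 ^ 33 + n.choose 5 * 2 ^ 14 + n.choose 4 * 2 ^ 6 +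
        n.choose 3 * 2 ^ 3 + n.choose 2 * 2 + n + 1 := by
    linarith
  -- (Y): `2^n ≤ Y + A + B`, `B ≤ Σ_{j ≤ d} C(n, j)`, and `Σ_{k ∈ Ico 12 p} C(n, k) + Σ_{j ≤ d} C(n, j) ≤ 2^n`
  have hY := Matroid.two_pow_le_midCount_add (M := M) p 12 hR
  have hB := Matroid.ncard_spanning_le (M := M) hencard
  rw [hEcard] at hY hB
  push_cast at hY
  have hsplit := sum_Ico_choose_add_sum_range_choose_le_twelve p d
  rw [← hnd] at hsplit
  have hYge : ∑ k ∈ Finset.Ico 12 p, n.choose k ≤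
      Matroid.midCount M p 12 + {X : Set α | X ⊆ M.E ∧ M.eRk X ≤ 12}.ncard := by
    omega
  -- assemble in `ℚ`
  have hΦ := phiK_le_two_pow_div p 12
  rw [Nat.choose_symm_add] at hΦ
  rw [RLS_iff]
  have hc : (0 : ℚ) < ((p + 12).choose 12 : ℚ) := by exact_mod_cast Nat.choose_pos (by omega)
  have hU0 : (0 : ℚ) ≤ (Matroid.topCount M p 12 : ℚ) := Nat.cast_nonneg _
  have hUq : (Matroid.topCount M p 12 : ℚ) ≤ (n.choose 12 : ℚ) * 2 ^ 2547 := by exact_mod_cast hU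
  have hAq : ({X : Set α | X ⊆ M.E ∧ M.eRk X ≤ 12}.ncard : ℚ) ≤
      ((n.choose 12 * 2 ^ 2547 + n.choose 11 * 2 ^ 1268 + n.choose 10 * 2 ^ 629 + n.choose 9 * 2 ^ 310 + n.choose 8 * 2 ^ 151 + n.choose 7 * 2 ^ 72 + n.choose 6 * 2 ^ 33 + n.choose 5 * 2 ^ 14 + n.choose 4 * 2 ^ 6 +
        n.choose 3 * 2 ^ 3 + n.choose 2 * 2 + n + 1 : ℕ) : ℚ) := by exact_mod_cast hA
  have hYq : ((∑ k ∈ Finset.Ico 12 p, n.choose k : ℕ) : ℚ) ≤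
      (Matroid.midCount M p 12 : ℚ) + ({X : Set α | X ⊆ M.E ∧ M.eRk X ≤ 12}.ncard : ℚ) := by exact_mod_cast hYge
  have hΦU : phiK p 12 * (Matroid.topCount M p 12 : ℚ) ≤
      (2 : ℚ) ^ (p + 2559) * (n.choose 12 : ℚ) / ((p + 12).choose 12 : ℚ) := by
    have e : (2 : ℚ) ^ (p + 2559) = 2 ^ (p + 12) * 2 ^ 2547 := by rw [← pow_add]
    generalize hE : (2 : ℚ) ^ 2547 = E at e hUq ⊢
    calc phiK p 12 * (Matroid.topCount M p 12 : ℚ)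
        ≤ (2 : ℚ) ^ (p + 12) / ((p + 12).choose 12 : ℚ) * ((n.choose 12 : ℚ) * E) :=
          mul_le_mul hΦ hUq hU0 (by positivity)
      _ = (2 : ℚ) ^ (p + 2559) * (n.choose 12 : ℚ) / ((p + 12).choose 12 : ℚ) := by
          rw [e]; ring
  calc phiK p 12 * (Matroid.topCount M p 12 : ℚ)
      ≤ (2 : ℚ) ^ (p + 2559) * (n.choose 12 : ℚ) / ((p + 12).choose 12 : ℚ) := hΦU
    _ ≤ ((∑ k ∈ Finset.Ico 12 p, n.choose k : ℕ) : ℚ) -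
        ((n.choose 12 * 2 ^ 2547 + n.choose 11 * 2 ^ 1268 + n.choose 10 * 2 ^ 629 + n.choose 9 * 2 ^ 310 + n.choose 8 * 2 ^ 151 + n.choose 7 * 2 ^ 72 + n.choose 6 * 2 ^ 33 + n.choose 5 * 2 ^ 14 +
          n.choose 4 * 2 ^ 6 + n.choose 3 * 2 ^ 3 + n.choose 2 * 2 + n + 1 : ℕ) : ℚ) := by linarith [hineq]
    _ ≤ ((∑ k ∈ Finset.Ico 12 p, n.choose k : ℕ) : ℚ) -
        ({X : Set α | X ⊆ M.E ∧ M.eRk X ≤ 12}.ncard : ℚ) := by linarith [hAq]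
    _ ≤ (Matroid.midCount M p 12 : ℚ) := by linarith [hYq]

end ThmN
end PercRepro
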